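import Literature.Probability.RandomPlanarGeometry.SLEKappaRhoFillVersion
import Literature.Probability.RandomPlanarGeometry.SLEKappaRhoLogDerivPos
import Literature.Probability.RandomPlanarGeometry.SLEKappaRhoRealKoebe
import Literature.Probability.RandomPlanarGeometry.SLEKappaRhoAssemblyProofs
import HarnessLib

/-!
# No positive real point in `cl K_∞` for SLE(κ, ρ), `κ < 4`: the closure leaf of [LSW] Thm. 8.4 discharged

Proof-only sibling of `SLEKappaRhoFillVersion` (no definitions, no named facts), discharging the
named fact
`Literature.Probability.RandomPlanarGeometry.SLEKappaRho.ae_forall_ofReal_notMem_closure_hullUnion`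
vendored there — for `ρ > -2` and every SLE(8/3, ρ) driving pair, almost surely no point of
`(0, ∞)` lies in the closure of `K_∞ = ⋃ₜ K_t` — after

* G. F. Lawler, O. Schramm, W. Werner, *Conformal restriction: the chordal case*, J. Amer. Math.
  Soc. **16** (2003) 917–955, arXiv:math/0209343 (**[LSW]**), Lemma 8.3 (2)–(3) (p. 36: for
  `κ ≤ 4`, "a.s. `1 ∉ K_t` for all `t ≥ 0` […] Scale invariance then implies
  `K_∞ ∩ (0, ∞) = ∅` a.s.") and Thm. 8.4 (p. 37: "let `K = F^{ℝ₊}_ℍ(cl K_∞)` […] Then `K`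
  satisfies the right-sided restriction property", i.e. `K ∈ Ω₊`, `K ∩ ℝ = (-∞, 0]`, so that
  `cl K_∞ ∩ (0, ∞) = ∅` — the passage from `K_∞` to its closure being implicit there and
  addressed at the end of the proof, p. 38, through the avoidance formula);
* S. Rohde, O. Schramm, *Basic properties of SLE*, Ann. of Math. **161** (2005), Lemma 7.2 and
  its proof (p. 909): for `κ ≤ 4`, a.s. `x ∉ cl γ[0, ∞)`, by the Koebe bound and "it suffices
  to show that a.s. `sup_{t ≥ 0} Q(t) < ∞`".

The tree's earlier derivation (`SLEKappaRho.ae_forall_ofReal_notMem_closure_hullUnion_of_restriction_leaves`)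
goes through the avoidance formula, i.e. through the one-sided restriction martingale of [LSW]
Lemmas 8.9–8.10 and Lemma 6.2 (named facts). Here the statement is PROVED by Rohde–Schramm's
argument for Lemma 7.2 run for the SLE(κ, ρ) flows `dX = (2/X - ρ J) dt - √κ dB` (files
`SLEKappaRhoRealKoebe`, `SLEKappaRhoFlow`, `SLEKappaRhoRegular`, `SLEKappaRhoLogCut`,
`SLEKappaRhoFlowIto`, `SLEKappaRhoLogDeriv`, `SLEKappaRhoLogDerivPos`), with [LSW] Lemma 8.3 (2) on
the positive axis (non-swallowing, the tree's `SLEKappaRho.swallowingTime_ofReal_pos_holds`) as the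
only input from §8:

* `SLEKappaRho.ae_forall_ofReal_notMem_closure_hullUnion_of_lt_four` — for `0 < κ < 4`, `ρ > -2`
  and every SLE(κ, ρ) driving pair, a.s. no positive real point lies in `cl K_∞`;
* `SLEKappaRho.ae_forall_ofReal_notMem_closure_hullUnion_holds` — **the discharge** (`κ = 8/3`);
* consequences, now unconditional: `SLEKappaRho.exists_measurable_fill_version_holds` — "`K =
  F^{ℝ₊}_ℍ(cl K_∞)` of SLE(8/3, ρ) is a random element of `Ω₊`" (the named fact
  `SLEKappaRho.exists_measurable_fill_version` of `SLEKappaRho`, by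
  `SLEKappaRho.exists_measurable_fill_version_of_leaves`), and [LSW] Thm. 8.4 in law form from the
  THREE remaining leaves of its avoidance formula
  (`SLEKappaRho.isRightRestrictionMeasure_fill_of_three_leaves`: the martingale of Lemmas
  8.9–8.10, Lemma 6.2, Lemma 6.3).
-/

noncomputable section

open Set Filter Topology MeasureTheory
open scoped NNReal
open Literature.Probability.Process

namespace Literature.Probability.RandomPlanarGeometry

/-- **No positive real point in `cl K_∞`, a.s., for SLE(κ, ρ) with `0 < κ < 4`, `ρ > -2`, given that
a.s. no positive real point is ever swallowed.** A regular version of the driving process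
(`IsSLEKappaRhoPair.exists_regularPair`) has, for every pair `0 < y < x`, an a.s. bound on
`t ↦ log |g_t'(x)| - log |g_t'(y)|` (`SLEKappaRho.RegularPair.ae_exists_forall_log_deriv_sub_le_all`);
with the a.s. continuity of the paths (`IsSLEKappaRhoPair.ae_continuous`) and the non-swallowing
hypothesis, the hull form of Rohde–Schramm's Koebe route
(`Loewner.ae_forall_ofReal_notMem_closure_hullUnion_of_bounds`) concludes.
[cite: RohdeSchramm2005, proof of Lemma 7.2 (p. 909)] -/
theorem SLEKappaRho.ae_forall_ofReal_notMem_closure_hullUnion_of_ae_swallowingTime_eq_top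
    {κ : ℝ≥0} {ρ : ℝ} {O W : ℝ≥0 → (ℝ≥0 → ℝ) → ℝ} (hκ0 : 0 < κ) (hκ4 : κ < 4) (hρ : -2 < ρ)
    (hOW : IsSLEKappaRhoPair κ ρ O W)
    (hT : ∀ᵐ ω ∂preWienerMeasure, ∀ x : ℝ, 0 < x → Loewner.swallowingTime (fun t ↦ W t ω) x = ⊤) :
    ∀ᵐ ω ∂preWienerMeasure, ∀ x : ℝ, 0 < x →
      (x : ℂ) ∉ closure (Loewner.hullUnion fun t ↦ W t ω) := by
  obtain ⟨W', J, h⟩ := hOW.exists_regularPair hκ0 hρ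
  have hc : ∀ᵐ ω ∂preWienerMeasure, Continuous (fun t ↦ W t ω) ∧ W 0 ω = 0 := by
    filter_upwards [hOW.ae_continuous SLEKappaRho.integral_inv_eq_holds hκ0 hρ] with ω hω
    exact ⟨hω.1, hOW.snd_zero ω⟩
  refine Loewner.ae_forall_ofReal_notMem_closure_hullUnion_of_bounds hc hT fun x y hy hyx ↦ ?_
  exact h.ae_exists_forall_log_deriv_sub_le_all hκ4 hy hyx.le
    (hT.mono fun ω hω ↦ hω x (hy.trans hyx)) (hT.mono fun ω hω ↦ hω y hy)

/-- **No positive real point in `cl K_∞`, a.s., for SLE(κ, ρ) with `0 < κ < 4`, `ρ > -2`** —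
unconditionally: [LSW] Lemma 8.3 (2) on the positive axis is the tree's theorem
`SLEKappaRho.swallowingTime_ofReal_pos_holds`, and the rest is
`SLEKappaRho.ae_forall_ofReal_notMem_closure_hullUnion_of_ae_swallowingTime_eq_top`. This is the
closure form of Lemma 8.3 (2)–(3) on `(0, ∞)` ("`K_∞ ∩ (0, ∞) = ∅` a.s."; in Thm. 8.4,
`K = F^{ℝ₊}_ℍ(cl K_∞) ∈ Ω₊`, so `cl K_∞ ∩ (0, ∞) = ∅`).
[cite: LawlerSchrammWerner2003Restriction, Lemma 8.3 (2)–(3) (p. 36) with Thm. 8.4 (p. 37)] -/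
theorem SLEKappaRho.ae_forall_ofReal_notMem_closure_hullUnion_of_lt_four
    {κ : ℝ≥0} {ρ : ℝ} {O W : ℝ≥0 → (ℝ≥0 → ℝ) → ℝ} (hκ0 : 0 < κ) (hκ4 : κ < 4) (hρ : -2 < ρ)
    (hOW : IsSLEKappaRhoPair κ ρ O W) :
    ∀ᵐ ω ∂preWienerMeasure, ∀ x : ℝ, 0 < x →
      (x : ℂ) ∉ closure (Loewner.hullUnion fun t ↦ W t ω) :=
  SLEKappaRho.ae_forall_ofReal_notMem_closure_hullUnion_of_ae_swallowingTime_eq_top hκ0 hκ4 hρ hOW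
    (SLEKappaRho.swallowingTime_ofReal_pos_holds hκ0 hκ4.le hρ hOW)

/-- `8/3 < 4` in `ℝ≥0`. [folklore] -/
theorem eight_thirds_lt_four : (8 : ℝ≥0) / 3 < 4 := by
  rw [div_lt_iff₀ (by norm_num : (0 : ℝ≥0) < 3)]
  norm_num

/-- **DISCHARGE of `SLEKappaRho.ae_forall_ofReal_notMem_closure_hullUnion`** ([LSW] Lemma 8.3
(2)–(3) with Thm. 8.4: for `ρ > -2` and every SLE(8/3, ρ) driving pair, almost surely no point of
`(0, ∞)` lies in `cl K_∞`): the case `κ = 8/3 < 4` of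
`SLEKappaRho.ae_forall_ofReal_notMem_closure_hullUnion_of_lt_four`. In print the closure
statement is implicit in Thm. 8.4's "`K = F^{ℝ₊}_ℍ(cl K_∞)` satisfies the right-sided restriction
property" (`K ∈ Ω₊`) and is addressed through the avoidance formula (end of the proof, p. 38);
here it is obtained from Lemma 8.3 (2) and Rohde–Schramm's argument for Lemma 7.2 of *Basic
properties of SLE* adapted to the SLE(κ, ρ) flows.
[cite: LawlerSchrammWerner2003Restriction, Lemma 8.3 (2)–(3) (p. 36) with Thm. 8.4 (p. 37) and the end of its proof (p. 38)] -/
theorem SLEKappaRho.ae_forall_ofReal_notMem_closure_hullUnion_holds :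
    SLEKappaRho.ae_forall_ofReal_notMem_closure_hullUnion :=
  fun hρ hOW ↦ SLEKappaRho.ae_forall_ofReal_notMem_closure_hullUnion_of_lt_four (by positivity)
    eight_thirds_lt_four hρ hOW

/-! ### Consequences -/

/-- **DISCHARGE of `SLEKappaRho.exists_measurable_fill_version`** (`SLEKappaRho`; [LSW] Thm. 8.4
with §8.1 and Lemma 8.3: "`K = F^{ℝ₊}_ℍ(cl K_∞)` of SLE(8/3, ρ) is a random element of `Ω₊`",
i.e. has a measurable `Ω₊`-valued version): by the tree's reduction
`SLEKappaRho.exists_measurable_fill_version_of_leaves` (`SLEKappaRhoFillVersion`) to the integrated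
Bessel equation (`SLEKappaRho.integral_inv_eq_holds`) and the closure leaf
(`SLEKappaRho.ae_forall_ofReal_notMem_closure_hullUnion_holds`).
[cite: LawlerSchrammWerner2003Restriction, Thm. 8.4 (p. 37) with §8.1 (p. 31) and Lemma 8.3 (p. 36)] -/
theorem SLEKappaRho.exists_measurable_fill_version_holds : SLEKappaRho.exists_measurable_fill_version :=
  SLEKappaRho.exists_measurable_fill_version_of_leaves SLEKappaRho.integral_inv_eq_holds
    SLEKappaRho.ae_forall_ofReal_notMem_closure_hullUnion_holds

/-- **[LSW] Theorem 8.4 in law form from the THREE remaining leaves of its avoidance formula**: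
the law of the `Ω₊`-valued version of `F^{ℝ₊}_ℍ(cl K_∞)` for SLE(8/3, ρ) is the right-sided
restriction measure `P⁺_{α(ρ)}` (`SLEKappaRho.isRightRestrictionMeasure_fill`), given the one-sided
restriction martingale of Lemmas 8.9–8.10 (`SLEKappaRho.exists_isOneSidedMartingale`), Lemma 6.2
(`Loewner.restrictionDeriv_exitTime_gt`) and Lemma 6.3 (`IsSmoothHull.restrictionDerivVanishesAtHit`)
— the tree's five-leaf assembly `SLEKappaRho.isRightRestrictionMeasure_fill_of_five_leaves` with the
integrated Bessel equation (`SLEKappaRho.integral_inv_eq_holds`) and Lemma 8.3 (2)–(3)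
(positive-axis part, `SLEKappaRho.swallowingTime_ofReal_pos_holds`, fed through
`SLEKappaRho.isRightRestrictionMeasure_fill_of_weak_leaves`) now proved.
[cite: LawlerSchrammWerner2003Restriction, Thm. 8.4 (p. 37) and its proof (§8.4)] -/
theorem SLEKappaRho.isRightRestrictionMeasure_fill_of_three_leaves
    (hM : SLEKappaRho.exists_isOneSidedMartingale) (h62 : Loewner.restrictionDeriv_exitTime_gt)
    (h63 : IsSmoothHull.restrictionDerivVanishesAtHit) : SLEKappaRho.isRightRestrictionMeasure_fill :=
  SLEKappaRho.isRightRestrictionMeasure_fill_of_weak_leaves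
    (SLEKappaRho.intervalIntegrable_inv_of SLEKappaRho.integral_inv_eq_holds) hM h62 h63
    SLEKappaRho.swallowingTime_ofReal_pos_holds

end Literature.Probability.RandomPlanarGeometry

end
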